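import Literature.Claims.NS.ClayVariants
import Literature.Claims.NS.ClayTorusBridge
import Literature.Analysis.FluidPDE.TorusClassicalNSMaximalSolution
import Literature.Analysis.FluidPDE.TorusClassicalH1Balance
import Literature.Analysis.FunctionSpaces.TorusTrigPoly
import Literature.Analysis.FunctionSpaces.TorusClassicalNSGluing
import HarnessLib

/-!
# Claim skeleton: Chaabani (2020), «Global in time existence of strong solution to 3D periodic
# Navier-Stokes equations» — interval continuation by a low/high-frequency dichotomy

Cell `ns-claims` (D-0090 NS-CLAIMS SWEEP), claim C22, typist `ns-claims-typist-5`. UNREFEREED CLAIM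
under adjudication — NOTHING in this file asserts a step: every `Step_k` is a `Prop`; the only
`theorem`s are the kernel COMPOSITIONS of the paper's own implications and bookkeeping.

Version of record: A. Chaabani, arXiv:2004.06956 **v1** (2020-04-15, only version, 9 pp., math.GM)
[Chaabani2020]; locators `l.N` = TeX lines of `v1-2020-04-15-main.tex`, `p.N` = PDF page
(`pub/ns-claims/sources/Chaabani2020/`, `LOCATORS.md` by ns-claims-lit-2). No other version is held
(preprints.org 202003.0278 v1/v2 not accessible); no public localisation known.

## Claimed statement (as printed)

Theorem 1.3 (l.139–141, p.3), introduced by «In this paper, we prove the statement (B) which can be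
alternatively formulated as follows» (l.138): «For every u_0 ∈ H¹_σ(𝕋³) there exists a unique global
in time strong solution u ∈ L^∞(0,∞;H¹_σ(𝕋³)) ∩ L²(0,∞;H²(𝕋³)) of the Navier-Stokes equations.»
Setting (l.81–115): (NSE) on 𝕋³ = ℝ³/ℤ³, `ν > 0`, `f ≡ 0`, Leray-projected form (NS).

## Typing decisions

* CARRIER / LEVEL. Unit flat torus `UnitAddTorus (Fin 3)`; the proof's estimates are made «directly
  for u» on its interval of existence as a STRONG solution (l.189), smooth for `t > 0` (Thm 1.4,
  l.145–149); they are typed for CLASSICAL solutions `FunctionSpaces.Torus.IsClassicalNSSolutionOn`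
  with mean-zero slices — the tree's maximal-solution vocabulary (`Literature.Analysis.FluidPDE.
  Torus.exists_maximal_classicalNS`, Robinson–Rodrigo–Sadowski 2016 §6.3/§8.1). The claimed theorem is
  typed for SMOOTH divergence-free mean-zero data (`ClaimedTheorem`): the printed `H¹_σ` data class is
  wider (Δ4, STRONGER direction, `-- TODO(general form)`), the printed statement has no mean-zero
  restriction (the paper's estimates never use the mean; Galilean reduction on 𝕋³ — recorded in
  `ClayDelta`). «T_max»: Theorem 1.2 (l.128–130) DEFINES `T_max = C/‖∇u_0‖⁴_{L²}` (a guaranteed local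
  time) while the abstract and l.274–284 use it as «the maximal time of existence»; typed in the
  CHARITABLE reading (maximal time, blow-up alternative `Step_1`) — under the literal reading the last
  sentence l.284 («Therefore, the solution u can be extended into a global in time strong solution»)
  is a non-implication (F12), recorded here, not typed.
* FOURIER BOOKKEEPING (l.195–215): `absCoeff v k = |v̂(k)|` (Mathlib `UnitAddTorus.mFourierCoeff` of
  the complexified field), `kNormSq k = |k|²`, `lowSum m v = Σ_{|k| ≤ m} |v̂(k)|`,
  `highSum m v = Σ_{|k| > m} |v̂(k)|` (as `tsum`s of indicator-restricted families; the slices they are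
  applied to are smooth, so the families are summable — no junk on the typed range),
  `splitF m v = lowSum − highSum` (= `F_m`, l.215), `countLow m = #{k : |k| ≤ m}`,
  `caseConst ν m = C(m) = 2·countLow m/ν` (l.224), `printedRule`/`correctedRule` (the multiplier of
  `‖∇u(t_0)‖²` in `m₀`, l.250 / l.246–248), `TailBound c₁` = «Σ_{|k|>m}|k|^{−4} ≤ c₁ m^{−1}» (l.237–241).
* CONSTANTS (A1/F11, HYGIENE 4): the paper fixes ONE absolute constant `c₁` at l.237–241 and uses it
  throughout; it is a shared explicit parameter `(c₁ : ℝ)` of `Step_2` («`c₁` is admissible») and of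
  the composition — never `∀ c₁` inside a step (any larger constant is also admissible, and a step
  uniform in `c₁` would assert small-data statements the author did not make). The wavenumber attached
  to an interval, `m₀ = rule ν · ‖∇u(t_0)‖²`, is abstracted to a parameter `rule : ℝ → ℝ` of
  `Step_5`/`Step_6`, instantiated by `printedRule c₁ ν = 8/(c₁ν²)` (l.250, AS PRINTED) and by
  `correctedRule c₁ ν = 8c₁/ν²` (what l.246–248 «m^{−1/2} < ν/(2c₁^*)‖∇u(t_0)‖^{−1}» requires) — see E1.
* ERRATUM E1 (typist's finding, recorded, not adjudicated here): l.244 «m > (4/(c₁ν²))‖∇u(t_0)‖²» and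
  l.246–248 «i.e. m^{−1/2} < (ν/(2c₁^*))‖∇u(t_0)‖^{−1}» (`c₁^* = √c₁`) are NOT equivalent — the second
  says `m > 4c₁‖∇u(t_0)‖²/ν²`; the paper continues with `c₁` in the denominator (l.250 `m₀`, l.255/257
  `2048c₂/(c₁³ν⁷)`). For an admissible `c₁` (the lattice forces `c₁ ≥ Σ_{|k|²>1}|k|^{−4} ≈ 10.5` at `m = 1`,
  and `m·Σ_{|k|>m}|k|^{−4} → 4π`) the printed factor `ν − 2c₁^* m₀^{−1/2}‖∇u(t_0)‖ = ν(1 − c₁/√2)` of l.245 is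
  NEGATIVE, so the printed proof of the case-(2.4) monotonicity does not run as printed; with
  `correctedRule` it runs verbatim (factor `ν(1 − 1/√2) > 0`). Both instances are typed
  (`Step_5 (printedRule c₁)` = Step 5 as printed, `Step_5 (correctedRule c₁)` = Step 5′), the
  elementary display itself as the support decl `Step_5Display` (HYGIENE 13 grain); the composition is
  uniform in `rule`, so E1 does not touch the architecture — the termination step (Step 6) is the same
  under either rule.

## Clay delta (reference `ClayVariants.lean`)

Nearest: (B) `ClayVariants.clayPeriodic.Regularity`. Δ1 domain 𝕋³ = ℝ³/ℤ³ (EQUIVALENT: periodic lift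
`IsClassicalNSSolutionOn.of_torus_holds`) · Δ2 NS, `ν > 0` (=) · Δ3 `f ≡ 0` (=) · Δ4 data: printed H¹_σ
(wider than Clay: STRONGER), typed C^∞ mean-zero (the mean-zero subclass: Galilean boost on 𝕋³) ·
Δ5 solution: strong, global; smooth for t > 0 by Thm 1.4 (RRS), classical here (=) · Δ6 conclusion
global + uniform-in-time H¹ bound (STRONGER than (B)) · Δ7 every `ν > 0` (=). Clay link: `ClayDelta` :=
«torus-level global regularity for smooth mean-zero data ⇒ (B)» (the Δ1/Δ4 bridge: lift + Galilean
normalisation of the mean + `IsSmoothOnHalfSpace` bookkeeping — classical, not assembled here);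
`clay_of_claimed_of_delta : ClayDelta → ClaimedTheorem → clayPeriodic.Regularity` PROVED. Not a
«wrong problem» candidate.

## Steps (ordered index, TYPING-HYGIENE 11; `c₁` = the constant of l.237–241, `rule` as above)

* Step 1 = `Step_1` — Thm 1.2 l.128–130 with l.156–188 and the continuation sentence l.282–284: the
  maximal classical solution and the H¹ blow-up alternative (classical; = tree
  `FluidPDE.Torus.exists_maximal_classicalNS`).
* Step 2 = `Step_2 c₁` — l.237–241: `c₁ > 0` and the lattice tail bound `Σ_{|k|>m}|k|^{−4} ≤ c₁ m^{−1}`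
  (classical for the admissible values, `c₁ ≳ 4π`).
* Step 3 = `Step_3` — l.210, p.5: «by a continuity argument one can always find at least a small
  interval of strictly positive length [t_0,t_1] ⊂ (0,T_max) on which either (2.3) or (2.4) occurs»
  (plausible; NOT consumed — only the LAST interval of the process enters the conclusion).
* Step 4 = `Step_4` — case (2.3), l.216–228, p.5–6 (Cauchy–Schwarz on |k| ≤ m, energy inequality
  (1.1), Grönwall): `‖∇u(t)‖² ≤ ‖∇u(t_0)‖² exp{2C(m)‖u_0‖²(t−t_0)}` (true, every `m`).
* Step 5 = `Step_5 (printedRule c₁)` — case (2.4) with `m₀ = (8/(c₁ν²))‖∇u(t_0)‖²`, l.230–250 and (2.7)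
  l.259–262, p.6–7: `‖∇u(t)‖ ≤ ‖∇u(t_0)‖` on the interval. AS PRINTED its proof rests on the display
  `Step_5Display c₁ (printedRule c₁)` (l.242–246), false for admissible `c₁` (E1); the statement itself
  is not decided here. Step 5′ = `Step_5 (correctedRule c₁)` (true: continuous induction, l.245–248
  verbatim). Support (not consumed): `Step_5Display c₁ rule`.
* Step 6a = `LastIntervalSign` — THE TERMINATION STEP at the scalar (F15) grain, l.274–282, p.8:
  «Repeating this process as many times as needed to obtain [t_0,T_max) = ∪_{j=0}^{N−1}[t_j,t_{j+1}] ∪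
  [t_N,T_max) … on the interval [t_N,T_max) either F_{m_N}(t) ≥ 0 holds true for all t ∈ [t_N,T_max) or
  F_{m_N}(t) ≤ 0 holds true for all t ∈ [t_N,T_max)», abstracted over the sign-test family `F` (the
  print invokes only its continuity/smoothness in `t`, (2.5) l.211–215) and the positive rule `μ`
  (`t_j ↦ m_j`); text = ns-claims-refuter-8's scaffold (INBOX 2026-08-26T20:45:06Z) verbatim, same name.
  Typist's flag: SUSPICIOUS (nothing printed bounds the number of sign changes before `T_max`).
* Step 6b = `Step_6 (printedRule c₁)` — the same display at solution level (= the conclusion of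
  `LastIntervalSign` for `F m t = F_m(u(t))`, `μ t = rule ν‖∇u(t)‖²`, from every `t_0 ∈ (0,T)`): what
  l.282–283 CONSUMES. No glue 6a ⇒ 6b is typed: the instantiation needs (2.5) and `m_j > 0`, which the
  print does not argue. Step 6b′ = `Step_6 (correctedRule c₁)`. For a maximal solution with `T* < ∞`
  the last-interval clause is the whole regularity problem (open-strength, not decided here).
* Step 7 = `Step_7` — implicit at l.284 («Therefore … a global in time strong solution», with the
  L^∞(0,∞;H¹) ∩ L²(0,∞;H²) clause of Thm 1.3): a global classical mean-zero solution on 𝕋³ has bounded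
  enstrophy on [0,∞) and `∫₀^∞‖Δu‖² < ∞` (classical: energy decay + eventual smallness; the printed
  bound (2.6) on the last interval grows exponentially in `t` and does not give it).

## COMPOSITION — proved

`claim_of_steps (c₁) (rule) : Step_1 → Step_2 c₁ → Step_3 → Step_4 → Step_5 rule → LastIntervalSign →
Step_6 rule → Step_7 → ClaimedTheorem` — PROVED, uniformly in `c₁` and `rule` (so for the printed and
the E1-corrected instances alike); consumes Steps 1, 4, 5, 6b, 7 (Steps 2, 3, 6a are taken in order and
unused: 2 only makes 5/6 true, 3 is superseded by 6, 6a is the print's support for 6b): in the blow-up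
branch of `Step_1`, `Step_6` yields a last interval `[t_N, T*)`, `Step_4`/`Step_5` bound `‖∇u‖₂²`
there by `‖∇u(t_N)‖² exp{2C(m_N)‖u_0‖²(T* − t_N)}` (l.252/(2.6) in the `C(m)` form; the printed
l.282–283 bound is its upper estimate via `Σ_{|k|≤m}1 ≤ c₂m³`, l.257), continuity of the enstrophy (the
tree's H¹ balance) bounds it on `[0, t_N]`, contradicting the blow-up alternative; in the global branch
`Step_7` supplies the printed function-space clause. The weight of the claim sits on Step 6 (6a/6b).

WHAT THIS IS NOT: not a claim about NS regularity or blow-up; not a claim about any author beyond the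
typed locator.
-/

open MeasureTheory Set Filter
open scoped ContDiff RealInnerProductSpace Topology

namespace Literature.Claims.NS.Chaabani2020

open Literature.Analysis

noncomputable section

/-! ## Vocabulary (definitions with bodies; nothing asserted) -/

/-- `|k|²` for a lattice frequency `k ∈ ℤ³` (the paper's `|k|`, l.107–110). (Chaabani2020: §1 l.107–110) [claim: Chaabani2020, status: disputed] -/
def kNormSq (k : Fin 3 → ℤ) : ℝ :=
  ∑ i, ((k i : ℝ)) ^ 2

/-- `|v̂(k)|`: the norm of the `k`-th Fourier coefficient of the (complexified) real vector field `v`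
on `𝕋³` (l.107–109; Mathlib `UnitAddTorus.mFourierCoeff`). (Chaabani2020: §1 l.107–110 and l.195–200) [claim: Chaabani2020, status: disputed] -/
def absCoeff (v : UnitAddTorus (Fin 3) → EuclideanSpace ℝ (Fin 3)) (k : Fin 3 → ℤ) : ℝ :=
  ‖UnitAddTorus.mFourierCoeff (FunctionSpaces.EuclideanSpace.complexify ∘ v) k‖

/-- `Σ_{|k| ≤ m} |v̂(k)|` (l.200, the low-frequency part). (Chaabani2020: l.195–204 p.4–5) [claim: Chaabani2020, status: disputed] -/
def lowSum (m : ℝ) (v : UnitAddTorus (Fin 3) → EuclideanSpace ℝ (Fin 3)) : ℝ :=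
  ∑' k : Fin 3 → ℤ, {k | kNormSq k ≤ m ^ 2}.indicator (absCoeff v) k

/-- `Σ_{|k| > m} |v̂(k)|` (l.200, the high-frequency part). (Chaabani2020: l.195–208 p.4–5) [claim: Chaabani2020, status: disputed] -/
def highSum (m : ℝ) (v : UnitAddTorus (Fin 3) → EuclideanSpace ℝ (Fin 3)) : ℝ :=
  ∑' k : Fin 3 → ℤ, {k | m ^ 2 < kNormSq k}.indicator (absCoeff v) k

/-- `F_m(t) = Σ_{|k|≤m}|û(k,t)| − Σ_{|k|>m}|û(k,t)|` (l.215): condition (2.3) is `0 ≤ F_m`, condition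
(2.4) is `F_m ≤ 0`. (Chaabani2020: l.202–215 p.5) [claim: Chaabani2020, status: disputed] -/
def splitF (m : ℝ) (v : UnitAddTorus (Fin 3) → EuclideanSpace ℝ (Fin 3)) : ℝ :=
  lowSum m v - highSum m v

/-- `#{k ∈ ℤ³ : |k| ≤ m}` as a real number (`Σ_{|k|≤m} 1`, l.220–224). (Chaabani2020: l.220–224 p.5–6) [claim: Chaabani2020, status: disputed] -/
def countLow (m : ℝ) : ℝ :=
  ∑' k : Fin 3 → ℤ, {k | kNormSq k ≤ m ^ 2}.indicator (fun _ => (1 : ℝ)) k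

/-- `C(m) = 2 (Σ_{|k|≤m} 1)/ν` (l.224). (Chaabani2020: l.224 p.6) [claim: Chaabani2020, status: disputed] -/
def caseConst (ν m : ℝ) : ℝ :=
  2 * countLow m / ν

/-- The PRINTED multiplier of `‖∇u(t_0)‖²_{L²}` in the wavenumber attached to an interval:
`m₀ = (8/(c₁ν²)) ‖∇u(t_0)‖²` (l.250; also `m_N`, l.282). See E1 in the module docstring. (Chaabani2020: l.250 p.7 and l.282 p.8) [claim: Chaabani2020, status: disputed] -/
def printedRule (c₁ ν : ℝ) : ℝ :=
  8 / (c₁ * ν ^ 2)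

/-- The multiplier that l.246–248 («m^{−1/2} < (ν/(2c₁^*))‖∇u(t_0)‖^{−1}», `c₁^* = √c₁`, doubled as on
l.250) actually requires: `m₀' = (8c₁/ν²) ‖∇u(t_0)‖²` — the E1-corrected reading, typed next to the
printed one (TYPING-HYGIENE 4). (Chaabani2020: l.246–248 p.7) [claim: Chaabani2020, status: disputed] -/
def correctedRule (c₁ ν : ℝ) : ℝ :=
  8 * c₁ / ν ^ 2

/-- The lattice tail bound with constant `c₁`: `Σ_{|k|>m} |k|^{−4} ≤ c₁ m^{−1}` for every `m > 0`
(l.237–241: «Σ_{|k|>m}|k|^{−4} ≤ c₁ ∫_m^∞ κ²/κ⁴ dκ ≤ c₁ m^{−1}»). (Chaabani2020: l.237–241 p.6) [claim: Chaabani2020, status: disputed] -/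
def TailBound (c₁ : ℝ) : Prop :=
  ∀ m : ℝ, 0 < m →
    ∑' k : Fin 3 → ℤ, {k | m ^ 2 < kNormSq k}.indicator (fun k => ((kNormSq k) ^ 2)⁻¹) k ≤ c₁ / m

/-! ## The claimed statement -/

/-- **Theorem 1.3 (l.139–141, p.3), typed at the smooth mean-zero level**: for every `ν > 0` and
every smooth divergence-free mean-zero datum `u₀` on `𝕋³` there is a classical solution `(u, p)` of
the unforced Navier–Stokes equations on `𝕋³ × [0,∞)` with `u(0) = u₀` and mean-zero slices, with
`u ∈ L^∞(0,∞;H¹)` (bounded enstrophy on `[0,∞)`) and `u ∈ L²(0,∞;H²)` (`∫₀ᵀ‖Δu‖² ≤ D` for all `T`),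
unique among classical solutions through `u₀` on closed windows. Printed for `u₀ ∈ H¹_σ(𝕋³)` and strong
solutions — TODO(general form): the `H¹` data class (Δ4, stronger) is not typed.
(Chaabani2020: Thm 1.3 l.139–141 p.3) [claim: Chaabani2020, status: disputed] -/
def ClaimedTheorem : Prop :=
  ∀ ν : ℝ, 0 < ν →
    ∀ u₀ : UnitAddTorus (Fin 3) → EuclideanSpace ℝ (Fin 3), FunctionSpaces.Torus.IsSmooth u₀ →
      FunctionSpaces.Torus.IsDivFree u₀ → FunctionSpaces.Torus.HasZeroMean u₀ →
      ∃ (u : ℝ → UnitAddTorus (Fin 3) → EuclideanSpace ℝ (Fin 3)) (p : ℝ → UnitAddTorus (Fin 3) → ℝ),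
        FunctionSpaces.Torus.IsClassicalNSSolutionOn (Ici 0) ν 0 u p ∧ u 0 = u₀ ∧
          (∀ t : ℝ, 0 ≤ t → FunctionSpaces.Torus.HasZeroMean (u t)) ∧
          BddAbove ((fun t => FunctionSpaces.Torus.gradNormSq (u t)) '' Ici 0) ∧
          (∃ D : ℝ, ∀ T : ℝ, 0 ≤ T →
            ∫ t in Icc 0 T, ∫ x, ‖FunctionSpaces.Torus.laplacian (u t) x‖ ^ 2 ≤ D) ∧
          ∀ (b : ℝ) (v : ℝ → UnitAddTorus (Fin 3) → EuclideanSpace ℝ (Fin 3))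
            (q : ℝ → UnitAddTorus (Fin 3) → ℝ),
            FunctionSpaces.Torus.IsClassicalNSSolutionOn (Icc 0 b) ν 0 v q → v 0 = u₀ →
              ∀ s ∈ Icc 0 b, v s = u s

/-- **The typed Clay delta (TYPING-HYGIENE 10 (b))**: torus-level global regularity for smooth
divergence-free MEAN-ZERO data at every `ν > 0` implies Clay (B) `clayPeriodic.Regularity` (data:
all smooth divergence-free `ℤ³`-periodic fields on `ℝ³`; solutions smooth on `ℝ³ × [0,∞)` with `u`
periodic). Axes: Δ1 (torus ↔ periodic lift, `IsClassicalNSSolutionOn.of_torus_holds`, EQUIVALENT) and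
Δ4 (mean-zero subclass ↔ all data by the Galilean change of frame `u(t,x) ↦ u(t, x − ct) + c` on 𝕋³);
classical bookkeeping, not assembled in this file. (Chaabani2020: l.131–138 p.2–3, «we prove the statement (B)») [claim: Chaabani2020, status: disputed] -/
def ClayDelta : Prop :=
  (∀ ν : ℝ, 0 < ν →
    ∀ u₀ : UnitAddTorus (Fin 3) → EuclideanSpace ℝ (Fin 3), FunctionSpaces.Torus.IsSmooth u₀ →
      FunctionSpaces.Torus.IsDivFree u₀ → FunctionSpaces.Torus.HasZeroMean u₀ →
      ∃ (u : ℝ → UnitAddTorus (Fin 3) → EuclideanSpace ℝ (Fin 3)) (p : ℝ → UnitAddTorus (Fin 3) → ℝ),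
        FunctionSpaces.Torus.IsClassicalNSSolutionOn (Ici 0) ν 0 u p ∧ u 0 = u₀) →
    ClayVariants.clayPeriodic.Regularity

/-! ## The steps -/

/-- **Step 1 — Theorem 1.2 (l.128–130, p.2) with §2 l.156–188 (Galerkin, enstrophy inequality (2.1),
comparison ODE (2.2), T_max ∼ ‖∇u_0‖^{−4}) and the continuation sentence l.282–284 («rules out the
blowup of u in H¹ as t approaches T_max … Therefore, the solution u can be extended»)**, charitable
reading: the MAXIMAL classical solution from a smooth divergence-free mean-zero datum exists and obeys
the H¹ blow-up alternative — either it is global (and unique on closed windows), or it lives on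
`[0,T*)`, `0 < T* < ∞`, with `‖∇u(t)‖²_{L²}` unbounded on `[0,T*)` (and every classical solution through
`u₀` on `[0,b]` has `b < T*`). Classical (Robinson–Rodrigo–Sadowski 2016 §6.3, §8.1; tree
`FluidPDE.Torus.exists_maximal_classicalNS`). (Chaabani2020: Thm 1.2 l.128–130, §2 l.156–188, l.282–284) [claim: Chaabani2020, status: disputed] -/
def Step_1 : Prop :=
  ∀ ν : ℝ, 0 < ν →
    ∀ u₀ : UnitAddTorus (Fin 3) → EuclideanSpace ℝ (Fin 3), FunctionSpaces.Torus.IsSmooth u₀ →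
      FunctionSpaces.Torus.IsDivFree u₀ → FunctionSpaces.Torus.HasZeroMean u₀ →
      ∃ (u : ℝ → UnitAddTorus (Fin 3) → EuclideanSpace ℝ (Fin 3)) (p : ℝ → UnitAddTorus (Fin 3) → ℝ),
        u 0 = u₀ ∧
        ((FunctionSpaces.Torus.IsClassicalNSSolutionOn (Ici 0) ν 0 u p ∧
            (∀ t : ℝ, 0 ≤ t → FunctionSpaces.Torus.HasZeroMean (u t)) ∧
            ∀ (b : ℝ) (v : ℝ → UnitAddTorus (Fin 3) → EuclideanSpace ℝ (Fin 3))
              (q : ℝ → UnitAddTorus (Fin 3) → ℝ),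
              FunctionSpaces.Torus.IsClassicalNSSolutionOn (Icc 0 b) ν 0 v q → v 0 = u₀ →
                ∀ s ∈ Icc 0 b, v s = u s) ∨
          ∃ T : ℝ, 0 < T ∧ FunctionSpaces.Torus.IsClassicalNSSolutionOn (Ico 0 T) ν 0 u p ∧
            (∀ t ∈ Ico 0 T, FunctionSpaces.Torus.HasZeroMean (u t)) ∧
            ¬ BddAbove ((fun t => FunctionSpaces.Torus.gradNormSq (u t)) '' Ico 0 T) ∧
            ∀ (b : ℝ) (v : ℝ → UnitAddTorus (Fin 3) → EuclideanSpace ℝ (Fin 3))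
              (q : ℝ → UnitAddTorus (Fin 3) → ℝ),
              FunctionSpaces.Torus.IsClassicalNSSolutionOn (Icc 0 b) ν 0 v q → v 0 = u₀ →
                b < T ∧ ∀ s ∈ Icc 0 b, v s = u s)

/-- **Step 2 — l.237–241, p.6: «Σ_{|k|>m}|k|^{−4} ≤ c₁∫_m^∞ κ²κ^{−4} dκ ≤ c₁ m^{−1}»**: the paper's fixed
absolute constant `c₁` is positive and satisfies the lattice tail bound («`c₁` is admissible»).
Classical for `c₁` large (counting lattice points in shells; necessarily `c₁ > 10`).
(Chaabani2020: l.237–241 p.6) [claim: Chaabani2020, status: disputed] -/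
def Step_2 (c₁ : ℝ) : Prop :=
  0 < c₁ ∧ TailBound c₁

/-- **Step 3 — l.210, p.5: «By Theorem 1.4 we have u ∈ C([0,T_max);H¹) and C((0,T_max);H²), then by
a continuity argument one can always find at least a small interval of strictly positive length
[t_0,t_1] ⊂ (0,T_max) on which either (2.3) or (2.4) occurs for any positive number m»**: for a
classical solution on `[0,T)`, every `m > 0` and every `t_0 ∈ (0,T)` admit `t_1 ∈ (t_0,T)` with
`F_m(u(t)) ≥ 0` on all of `[t_0,t_1]` or `F_m(u(t)) ≤ 0` on all of `[t_0,t_1]`. Plausible; not consumed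
by the composition. (Chaabani2020: l.210–215 p.5) [claim: Chaabani2020, status: disputed] -/
def Step_3 : Prop :=
  ∀ ν : ℝ, 0 < ν → ∀ T : ℝ, 0 < T →
    ∀ (u : ℝ → UnitAddTorus (Fin 3) → EuclideanSpace ℝ (Fin 3)) (p : ℝ → UnitAddTorus (Fin 3) → ℝ),
      FunctionSpaces.Torus.IsClassicalNSSolutionOn (Ico 0 T) ν 0 u p →
      ∀ m : ℝ, 0 < m → ∀ t₀ ∈ Ioo 0 T, ∃ t₁ ∈ Ioo t₀ T,
        (∀ t ∈ Icc t₀ t₁, 0 ≤ splitF m (u t)) ∨ (∀ t ∈ Icc t₀ t₁, splitF m (u t) ≤ 0)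

/-- **Step 4 — case (2.3), l.216–228, p.5–6**: «If condition (2.3) holds [on [t_0,t_1]]: … By using
the energy inequality for weak solutions (1.1) and dropping the viscous term …, we obtain
d/dt‖∇u(t)‖² ≤ 2C(m)‖u_0‖²‖∇u(t)‖². The Gronwall's inequality yields
‖∇u(t)‖² ≤ ‖∇u(t_0)‖² exp{2C(m)‖u_0‖²(t−t_0)} for all t ∈ [t_0,t_1]», `C(m) = 2(Σ_{|k|≤m}1)/ν`. Typed
for a classical mean-zero solution on `[0,T)`, any `m`, any `[t_0,t_1) ⊆ [0,T)` on which `F_m ≥ 0`;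
`‖u_0‖²` = `∫‖u(0)‖²`. Typist's flag: true (Cauchy–Schwarz, Parseval, energy inequality, Grönwall).
(Chaabani2020: l.216–228 p.5–6 and (2.6) l.274–277 p.8) [claim: Chaabani2020, status: disputed] -/
def Step_4 : Prop :=
  ∀ ν : ℝ, 0 < ν → ∀ T : ℝ, 0 < T →
    ∀ (u : ℝ → UnitAddTorus (Fin 3) → EuclideanSpace ℝ (Fin 3)) (p : ℝ → UnitAddTorus (Fin 3) → ℝ),
      FunctionSpaces.Torus.IsClassicalNSSolutionOn (Ico 0 T) ν 0 u p →
      (∀ t ∈ Ico 0 T, FunctionSpaces.Torus.HasZeroMean (u t)) →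
      ∀ m t₀ t₁ : ℝ, 0 ≤ t₀ → t₀ < t₁ → t₁ ≤ T →
        (∀ t ∈ Ico t₀ t₁, 0 ≤ splitF m (u t)) →
        ∀ t ∈ Ico t₀ t₁,
          FunctionSpaces.Torus.gradNormSq (u t) ≤
            FunctionSpaces.Torus.gradNormSq (u t₀) *
              Real.exp (2 * caseConst ν m * (∫ x, ‖u 0 x‖ ^ 2) * (t - t₀))

/-- **Step 5 — case (2.4) with the attached wavenumber, l.230–250 and (2.7) l.259–262, p.6–7**: «one
can choose the number m such that m > (4/(c₁ν²))‖∇u(t_0)‖² … Consequently … ‖∇u(t)‖ ≤ ‖∇u(t_0)‖ for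
all t ∈ [t_0,τ_1]. But as ‖∇u(t)‖ is continuous on [t_0,t_1], we obtain ‖∇u(t)‖ ≤ ‖∇u(t_0)‖ for all
t ∈ [t_0,t_1] … Let us associate the number m_0 = (8/(c₁ν²))‖∇u(t_0)‖² to the interval»: for every
classical mean-zero solution on `[0,T)` and every `[t_0,t_1) ⊆ [0,T)` on which `F_{m_0} ≤ 0`
(condition (2.4) for `m_0 = rule ν · ‖∇u(t_0)‖²`), the enstrophy does not exceed its value at `t_0`.
Instances: Step 5 = `Step_5 (printedRule c₁)` (AS PRINTED; printed proof broken by E1, statement not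
decided here), Step 5′ = `Step_5 (correctedRule c₁)` (true: continuous induction on the factor
`ν − 2c₁^* m_0'^{−1/2}‖∇u(t)‖ ≥ ν(1 − 1/√2)` at `t_0`). (Chaabani2020: l.230–250 p.6–7, (2.7) l.259–262, l.278–281 p.8) [claim: Chaabani2020, status: disputed] -/
def Step_5 (rule : ℝ → ℝ) : Prop :=
  ∀ ν : ℝ, 0 < ν → ∀ T : ℝ, 0 < T →
    ∀ (u : ℝ → UnitAddTorus (Fin 3) → EuclideanSpace ℝ (Fin 3)) (p : ℝ → UnitAddTorus (Fin 3) → ℝ),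
      FunctionSpaces.Torus.IsClassicalNSSolutionOn (Ico 0 T) ν 0 u p →
      (∀ t ∈ Ico 0 T, FunctionSpaces.Torus.HasZeroMean (u t)) →
      ∀ t₀ t₁ : ℝ, 0 ≤ t₀ → t₀ < t₁ → t₁ ≤ T →
        (∀ t ∈ Ico t₀ t₁,
          splitF (rule ν * FunctionSpaces.Torus.gradNormSq (u t₀)) (u t) ≤ 0) →
        ∀ t ∈ Ico t₀ t₁,
          FunctionSpaces.Torus.gradNormSq (u t) ≤ FunctionSpaces.Torus.gradNormSq (u t₀)

/-- **Support for Step 5 (HYGIENE 13 grain, NOT consumed) — the elementary display of l.242–246, p.7: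
«½ d/dt‖∇u‖² + {ν − 2c₁^* m^{−1/2}‖∇u(t)‖}‖Δu‖² ≤ 0, where c₁^* = √c₁. Since lim m^{−1/2} = 0, then one
can choose the number m such that m > (4/(c₁ν²))‖∇u(t_0)‖². In such a way, the factor
{ν − 2c₁^* m^{−1/2}‖∇u(t)‖} would still positive at least over a short interval of time [t_0,τ_1]»**,
read at `t = t_0` as a statement about positive reals `ν`, `E = ‖∇u(t_0)‖²`, `m`: above HALF the
interval wavenumber (`m > (rule ν/2)·E`; l.250 doubles the l.244 threshold) the factor is positive,
`2√c₁ · √E/√m < ν`. Instance `Step_5Display c₁ (printedRule c₁)` is the display AS PRINTED (false for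
every `c₁ > 1`, in particular for every admissible `c₁` — E1); `Step_5Display c₁ (correctedRule c₁)`
is true (what l.246–248 states). (Chaabani2020: l.242–248 p.7) [claim: Chaabani2020, status: disputed] -/
def Step_5Display (c₁ : ℝ) (rule : ℝ → ℝ) : Prop :=
  ∀ ν E m : ℝ, 0 < ν → 0 < E → 0 < m → rule ν / 2 * E < m →
    2 * Real.sqrt c₁ * (Real.sqrt E / Real.sqrt m) < ν

/-- **Step 6a — THE TERMINATION STEP at the scalar (F15) grain, l.274–282, p.8: «Repeating this process
as many times as needed to obtain [t_0,T_max) = ∪_{j=0}^{N−1}[t_j,t_{j+1}] ∪ [t_N,T_max) (where …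
[t_j,t_{j+1}] are successive intervals) … In fact, on the interval [t_N,T_max) either F_{m_N}(t) ≥ 0
holds true for all t ∈ [t_N,T_max) or F_{m_N}(t) ≤ 0 holds true for all t ∈ [t_N,T_max) where
m_N = (8/(c₁ν²))‖∇u(t_N)‖²»** — the printed inference abstracted over the sign-test family
`F m = (t ↦ F_m(t))` (of which the print invokes only continuity on `[t_0,T)` and smoothness on
`(t_0,T)`, (2.5) l.211–215 «prevents the abrupt bends of the function t ↦ F_m(t)») and over the positive
rule `μ` (`t_j ↦ m_j`): a FINITE chain of successive constant-sign intervals starting at `t_0` whose last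
member `[t_N, T)` has constant sign. Text = ns-claims-refuter-8's scaffold (INBOX 2026-08-26T20:45:06Z),
verbatim. Typist's flag: SUSPICIOUS — continuity/smoothness of `F_m` does not bound the number of sign
changes before `T_max`. (Chaabani2020: l.274–282 p.8, with (2.5) l.211–215 p.5) [claim: Chaabani2020, status: disputed] -/
def LastIntervalSign : Prop :=
  ∀ (t₀ T : ℝ), t₀ < T → ∀ F : ℝ → ℝ → ℝ,
    (∀ m, ContinuousOn (F m) (Set.Ico t₀ T)) → (∀ m, ContDiffOn ℝ ∞ (F m) (Set.Ioo t₀ T)) →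
    ∀ μ : ℝ → ℝ, (∀ t, 0 < μ t) →
    ∃ (N : ℕ) (t : ℕ → ℝ), t 0 = t₀ ∧ StrictMono t ∧ t N < T ∧
      (∀ j < N, (∀ s ∈ Set.Icc (t j) (t (j + 1)), 0 ≤ F (μ (t j)) s) ∨
               (∀ s ∈ Set.Icc (t j) (t (j + 1)), F (μ (t j)) s ≤ 0)) ∧
      ((∀ s ∈ Set.Ico (t N) T, 0 ≤ F (μ (t N)) s) ∨ (∀ s ∈ Set.Ico (t N) T, F (μ (t N)) s ≤ 0))

/-- **Step 6b — the termination step at SOLUTION level, l.274–282, p.8 (same display as Step 6a)**,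
typed as the conclusion of `LastIntervalSign` for the paper's data `F m t = F_m(u(t))`,
`μ t = rule ν · ‖∇u(t)‖²`, from every starting time `t_0 ∈ (0,T)` (l.210/l.296: «one can choose any
instant t_0 ∈ [0,T_max) as initial time»): for every classical mean-zero solution on `[0,T)`, `T > 0`,
there are `N` and times `t_0 < t_1 < … < t_N < T` with `F_{m_j}` of constant sign on each `[t_j,t_{j+1}]`
(`j < N`) and `F_{m_N}` of constant sign on the whole last interval `[t_N, T)`, `m_j = rule ν‖∇u(t_j)‖²`.
This is what l.282–283 CONSUMES («and hence lim_{t→T_max}‖∇u(t)‖² ≤ …»). Instances: Step 6b =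
`Step_6 (printedRule c₁)`, Step 6b′ = `Step_6 (correctedRule c₁)`. No glue from `LastIntervalSign` is
typed (its instantiation needs (2.5) for `t ↦ F_m(u(t))` and `m_j > 0`, not argued in print). Typist's
flag: SUSPICIOUS — for a maximal solution with `T* < ∞` the last-interval clause carries the whole
regularity problem (open-strength, not decided here). (Chaabani2020: l.274–283 p.8) [claim: Chaabani2020, status: disputed] -/
def Step_6 (rule : ℝ → ℝ) : Prop :=
  ∀ ν : ℝ, 0 < ν → ∀ T : ℝ, 0 < T →
    ∀ (u : ℝ → UnitAddTorus (Fin 3) → EuclideanSpace ℝ (Fin 3)) (p : ℝ → UnitAddTorus (Fin 3) → ℝ),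
      FunctionSpaces.Torus.IsClassicalNSSolutionOn (Ico 0 T) ν 0 u p →
      (∀ t ∈ Ico 0 T, FunctionSpaces.Torus.HasZeroMean (u t)) →
      ∀ t₀ ∈ Ioo 0 T, ∃ (N : ℕ) (t : ℕ → ℝ), t 0 = t₀ ∧ StrictMono t ∧ t N < T ∧
        (∀ j < N,
          (∀ s ∈ Icc (t j) (t (j + 1)),
              0 ≤ splitF (rule ν * FunctionSpaces.Torus.gradNormSq (u (t j))) (u s)) ∨
            (∀ s ∈ Icc (t j) (t (j + 1)),
              splitF (rule ν * FunctionSpaces.Torus.gradNormSq (u (t j))) (u s) ≤ 0)) ∧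
        ((∀ s ∈ Ico (t N) T, 0 ≤ splitF (rule ν * FunctionSpaces.Torus.gradNormSq (u (t N))) (u s)) ∨
          (∀ s ∈ Ico (t N) T, splitF (rule ν * FunctionSpaces.Torus.gradNormSq (u (t N))) (u s) ≤ 0))

/-- **Step 7 — implicit at l.284, p.8 («Therefore, the solution u can be extended into a global in
time strong solution», read with the function-space clause `u ∈ L^∞(0,∞;H¹_σ) ∩ L²(0,∞;H²)` of Thm 1.3
l.140)**: a GLOBAL classical mean-zero solution of the unforced equations on `𝕋³` has enstrophy
bounded on `[0,∞)` and `∫₀ᵀ ∫‖Δu‖² ≤ D` uniformly in `T`. Classical (energy decay on the torus makes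
the solution eventually small, then the enstrophy decays); the printed last-interval bound (2.6) grows
like `exp{c (t − t_N)}` and does not supply it. (Chaabani2020: l.282–284 p.8 with Thm 1.3 l.139–141 p.3) [claim: Chaabani2020, status: disputed] -/
def Step_7 : Prop :=
  ∀ ν : ℝ, 0 < ν →
    ∀ (u : ℝ → UnitAddTorus (Fin 3) → EuclideanSpace ℝ (Fin 3)) (p : ℝ → UnitAddTorus (Fin 3) → ℝ),
      FunctionSpaces.Torus.IsClassicalNSSolutionOn (Ici 0) ν 0 u p →
      (∀ t : ℝ, 0 ≤ t → FunctionSpaces.Torus.HasZeroMean (u t)) →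
        BddAbove ((fun t => FunctionSpaces.Torus.gradNormSq (u t)) '' Ici 0) ∧
          ∃ D : ℝ, ∀ T : ℝ, 0 ≤ T →
            ∫ t in Icc 0 T, ∫ x, ‖FunctionSpaces.Torus.laplacian (u t) x‖ ^ 2 ≤ D

/-! ## Kernel composition of the paper's implications -/

/-- Continuity bookkeeping (not a step): along a classical solution on a closed window `[0,b]`, `b > 0`,
the enstrophy `t ↦ ‖∇u(t)‖²` is bounded above on `[0,b]` (it is differentiable within `[0,b]` by the
tree's H¹ balance `IsClassicalNSSolutionOn.hasDerivWithinAt_half_gradNormSq`, hence continuous on the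
compact window). [cite: RobinsonRodrigoSadowskiCUP2016, §6.3 p. 108] -/
theorem bddAbove_gradNormSq_Icc {ν b : ℝ} (hb : 0 < b)
    {u : ℝ → UnitAddTorus (Fin 3) → EuclideanSpace ℝ (Fin 3)} {p : ℝ → UnitAddTorus (Fin 3) → ℝ}
    (h : FunctionSpaces.Torus.IsClassicalNSSolutionOn (Icc 0 b) ν 0 u p) :
    BddAbove ((fun t => FunctionSpaces.Torus.gradNormSq (u t)) '' Icc 0 b) := by
  have hcont : ContinuousOn (fun t => 2⁻¹ * FunctionSpaces.Torus.gradNormSq (u t)) (Icc 0 b) :=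
    fun t ht => (h.hasDerivWithinAt_half_gradNormSq hb ht).continuousWithinAt
  have hcont' : ContinuousOn (fun t => FunctionSpaces.Torus.gradNormSq (u t)) (Icc 0 b) := by
    have := hcont.const_smul (2 : ℝ)
    refine this.congr fun t _ => ?_
    simp
  exact isCompact_Icc.bddAbove_image hcont'

/-- **THE COMPOSITION (README Lean convention 4; hypotheses in step order: 1, 2, 3, 4, 5, 6a, 6b, 7).**
Theorem 1.3 at the smooth mean-zero level follows in the kernel from the typed steps, uniformly in the
paper's constant `c₁` and in the wavenumber rule (printed or E1-corrected); the proof CONSUMES Steps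
1, 4, 5, 6b, 7 (Steps 2, 3, 6a are taken and unused): in the blow-up branch of `Step_1` on `[0,T*)`,
`Step_6` (from `t_0 = T*/2`) yields `t_N ∈ [T*/2, T*)` and a constant sign of `F_{m_N}` on `[t_N,T*)`;
`Step_4` (sign `≥ 0`, `m = m_N`) or `Step_5` (sign `≤ 0`) bounds `‖∇u(t)‖²` on `[t_N,T*)` by
`‖∇u(t_N)‖²·exp{2C(m_N)‖u_0‖²(T* − t_N)}` (l.252 and l.282–283); `bddAbove_gradNormSq_Icc` bounds it on
`[0,t_N]`; together this contradicts the blow-up alternative, so the maximal solution is global, and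
`Step_7` gives the printed function-space clause; uniqueness is `Step_1`'s. (Chaabani2020: §2 l.274–284 p.8 and Thm 1.3 l.139–141 p.3) [claim: Chaabani2020, status: disputed] -/
theorem claim_of_steps (c₁ : ℝ) (rule : ℝ → ℝ) :
    Step_1 → Step_2 c₁ → Step_3 → Step_4 → Step_5 rule → LastIntervalSign → Step_6 rule → Step_7 →
      ClaimedTheorem := by
  intro h1 _ _ h4 h5 _ h6 h7 ν hν u₀ hu₀ hdiv hmean
  obtain ⟨u, p, hu0, hcases⟩ := h1 ν hν u₀ hu₀ hdiv hmean
  rcases hcases with ⟨hglob, hmz, huniq⟩ | ⟨T, hT, hsol, hmz, hunb, -⟩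
  · obtain ⟨hbdd, hL2⟩ := h7 ν hν u p hglob hmz
    exact ⟨u, p, hglob, hu0, hmz, hbdd, hL2, huniq⟩
  · exfalso
    apply hunb
    -- the last interval `[t_N, T)` of the process started at `t₀ = T/2`
    have ht₀ : T / 2 ∈ Ioo 0 T := ⟨half_pos hT, half_lt_self hT⟩
    obtain ⟨N, ts, hts0, htsmono, htsN, -, hsign⟩ := h6 ν hν T hT u p hsol hmz (T / 2) ht₀
    set tN : ℝ := ts N with htNdef
    have htN1 : T / 2 ≤ tN := by
      rw [← hts0, htNdef]
      exact htsmono.monotone (Nat.zero_le N)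
    have htN0 : 0 ≤ tN := (half_pos hT).le.trans htN1
    have htNT : tN < T := htsN
    -- the bound on `[t_N, T)` (l.282–283)
    set E0 : ℝ := ∫ x, ‖u 0 x‖ ^ 2 with hE0
    set mN : ℝ := rule ν * FunctionSpaces.Torus.gradNormSq (u tN) with hmN
    set B : ℝ := FunctionSpaces.Torus.gradNormSq (u tN) *
      Real.exp (2 * caseConst ν mN * E0 * (T - tN)) with hB
    have hE0nn : 0 ≤ E0 := integral_nonneg fun _ => by positivity
    have hcount : 0 ≤ countLow mN :=
      tsum_nonneg fun k => Set.indicator_nonneg (fun _ _ => zero_le_one) k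
    have hC : 0 ≤ caseConst ν mN := by
      rw [caseConst]
      exact div_nonneg (mul_nonneg (by norm_num) hcount) hν.le
    have hGN : 0 ≤ FunctionSpaces.Torus.gradNormSq (u tN) :=
      FunctionSpaces.Torus.gradNormSq_nonneg _
    have htail_bound : ∀ t ∈ Ico tN T, FunctionSpaces.Torus.gradNormSq (u t) ≤ B := by
      intro t ht
      rcases hsign with hpos | hneg
      · -- condition (2.3) on `[t_N, T)`: Step 4 with `m = m_N`
        have h := h4 ν hν T hT u p hsol hmz mN tN T htN0 htNT le_rfl hpos t ht
        refine h.trans ?_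
        rw [hB]
        refine mul_le_mul_of_nonneg_left (Real.exp_le_exp.mpr ?_) hGN
        have h1 : t - tN ≤ T - tN := by linarith [ht.2.le]
        exact mul_le_mul_of_nonneg_left h1 (mul_nonneg (mul_nonneg (by norm_num) hC) hE0nn)
      · -- condition (2.4) on `[t_N, T)`: Step 5 with `m_0 = m_N`
        have h := h5 ν hν T hT u p hsol hmz tN T htN0 htNT le_rfl hneg t ht
        refine h.trans ?_
        rw [hB]
        have hexp : 1 ≤ Real.exp (2 * caseConst ν mN * E0 * (T - tN)) :=
          Real.one_le_exp (mul_nonneg (mul_nonneg (mul_nonneg (by norm_num) hC) hE0nn)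
            (by linarith))
        simpa using mul_le_mul_of_nonneg_left hexp hGN
    -- the bound on `[0, t_N]` by continuity
    have hhead : BddAbove ((fun t => FunctionSpaces.Torus.gradNormSq (u t)) '' Icc 0 tN) := by
      rcases htN0.eq_or_lt with h0 | hpos
      · rw [← h0, Icc_self, image_singleton]
        exact bddAbove_singleton
      · exact bddAbove_gradNormSq_Icc hpos
          (hsol.mono (Icc_subset_Ico_right htNT) (uniqueDiffOn_Icc hpos))
    obtain ⟨B₀, hB₀⟩ := hhead
    refine ⟨max B₀ B, ?_⟩
    rintro _ ⟨t, ht, rfl⟩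
    rcases lt_or_ge t tN with hlt | hge
    · exact (hB₀ ⟨t, ⟨ht.1, hlt.le⟩, rfl⟩).trans (le_max_left _ _)
    · exact (htail_bound t ⟨hge, ht.2⟩).trans (le_max_right _ _)

/-- **The Clay link through the typed delta**: `ClaimedTheorem` gives torus-level global regularity
for smooth mean-zero data; `ClayDelta` carries it to Clay (B). (Chaabani2020: l.131–138 p.2–3) [claim: Chaabani2020, status: disputed] -/
theorem clay_of_claimed_of_delta (hΔ : ClayDelta) (h : ClaimedTheorem) :
    ClayVariants.clayPeriodic.Regularity :=
  hΔ fun ν hν u₀ hu₀ hdiv hmean => by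
    obtain ⟨u, p, hsol, hu0, -⟩ := h ν hν u₀ hu₀ hdiv hmean
    exact ⟨u, p, hsol, hu0⟩

/-- **The typed Clay delta is a THEOREM** (Δ1 torus ↔ periodic lift and Δ4 mean-zero ↔ all data by the
Galilean change of frame, both classical): torus-level global classical solvability for smooth
divergence-free mean-zero data at `ν` is EQUIVALENT to Clay (B) at `ν` — the tree's
`ClayVariants.clayPeriodic_regularityAt_iff_torus_zeroMean` (file `ClayTorusBridge`), applied at every
`ν > 0`. Net effect: `clay_of_claimed` below is unconditional. Literature-side twin of the summit
tree's `Summit.NavierStokesRegularity.NavierStokesRegularity.Theorems.Chaabani2020.clayDelta_holds`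
(`Theorems/SoloSalvageChaabani2020.lean`, salvage lane; not importable here), recorded in the skeleton so
that the named fact `ClayDelta` is discharged where it is declared. [cite: FeffermanClay2006, (B) with (8) (10) (11) p. 2]
[cite: MajdaBertozziCUP2002, §1.2 (Galilean invariance)] -/
theorem clayDelta_holds : ClayDelta := fun h ν hν =>
  (ClayVariants.clayPeriodic_regularityAt_iff_torus_zeroMean hν).2 (h ν hν)

/-- **The Clay link, unconditional**: `ClaimedTheorem → Clay (B)` (`clay_of_claimed_of_delta` fed with
`clayDelta_holds`; twin of `Summit.….Theorems.Chaabani2020.clay_of_claimed`). (Chaabani2020: l.131–138 p.2–3 «we prove the statement (B)») [claim: Chaabani2020, status: disputed] -/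
theorem clay_of_claimed (h : ClaimedTheorem) : ClayVariants.clayPeriodic.Regularity :=
  clay_of_claimed_of_delta clayDelta_holds h

/-! ## Rev (typist-5 g5, D-0026 debt pass) — Step 1 and the E1-corrected display hold (nothing above changed) -/

/-- **Step 1 HOLDS (Thm 1.2 l.128–130, §2 l.156–188, continuation sentence l.282–284, charitable
reading)**: the maximal classical solution from a smooth divergence-free mean-zero datum on `𝕋³` with
the `H¹` blow-up alternative — verbatim the tree's `FluidPDE.Torus.exists_maximal_classicalNS`
(Robinson–Rodrigo–Sadowski 2016 §6.3 p.108 / §8.1 p.122; Leray 1934). Literature-side twin of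
`Summit.NavierStokesRegularity.NavierStokesRegularity.Theorems.Chaabani2020.step1_holds`
(SoloSalvageChaabani2020.lean, not importable here). (Chaabani2020: Thm 1.2 l.128–130, §2 l.156–188, l.282–284) [claim: Chaabani2020, status: disputed] [cite: RobinsonRodrigoSadowskiCUP2016, §6.3 p. 108 and §8.1 p. 122] -/
theorem step_1_holds : Step_1 := fun _ν hν _u₀ hu₀ hdiv hmean =>
  FluidPDE.Torus.exists_maximal_classicalNS (d := Fin 3) (by simp) hν hu₀ hdiv hmean

/-- **The display l.242–248 p.7 in the E1-corrected reading HOLDS for every `c₁`**: for `ν, E, m > 0`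
with `(8c₁/ν²)/2 · E < m` one has `2√c₁ · √E / √m < ν` (for `c₁ ≤ 0` trivially, `√c₁ = 0`) — elementary
real arithmetic; what «m^{−1/2} < (ν/(2c₁^*))‖∇u(t_0)‖^{−1}» (l.246–248) says with `E = ‖∇u(t_0)‖²`.
Literature-side twin of `Summit.….Theorems.Chaabani2020.step5Display_corrected_holds`; the printed
instance `Step_5Display c₁ (printedRule c₁)` is false for admissible `c₁ > 1`
(`Summit.….Theorems.Chaabani2020.not_step5Display_printed`, not restated here).
(Chaabani2020: §2 l.242–248 p.7) [claim: Chaabani2020, status: disputed] -/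
theorem step_5Display_corrected_holds (c₁ : ℝ) : Step_5Display c₁ (correctedRule c₁) := by
  intro ν E m hν hE hm hlt
  have hc8 : correctedRule c₁ ν / 2 * E = 4 * c₁ / ν ^ 2 * E := by
    simp only [correctedRule]; ring
  rw [hc8] at hlt
  have hsm : 0 < Real.sqrt m := Real.sqrt_pos.2 hm
  rw [← mul_div_assoc, div_lt_iff₀ hsm]
  by_cases hc : c₁ ≤ 0
  · rw [Real.sqrt_eq_zero'.2 hc]
    have : 0 < ν * Real.sqrt m := mul_pos hν hsm
    linarith
  · push Not at hc
    -- `4 c₁ E < ν² m`, i.e. `(2√c₁ √E)² < (ν √m)²`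
    have hν2 : 0 < ν ^ 2 := by positivity
    have h1 : 4 * c₁ * E < ν ^ 2 * m := by
      have h' : 4 * c₁ * E / ν ^ 2 < m := by rwa [mul_div_right_comm]
      exact (div_lt_iff₀' hν2).1 h'
    have hlhs : 0 ≤ 2 * Real.sqrt c₁ * Real.sqrt E := by positivity
    have hrhs : 0 ≤ ν * Real.sqrt m := by positivity
    have hsq : (2 * Real.sqrt c₁ * Real.sqrt E) ^ 2 < (ν * Real.sqrt m) ^ 2 := by
      rw [mul_pow, mul_pow, mul_pow, Real.sq_sqrt hc.le, Real.sq_sqrt hE.le, Real.sq_sqrt hm.le]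
      linarith
    exact lt_of_pow_lt_pow_left₀ 2 hrhs hsq

/-! ## H. Step 2 holds for every admissible constant `c₁ ≥ 52√3` (l.237–241, p.6)

D-0026 own-lineage debt pass (ns-claims-typist-5 g6, 2026-08-27): the binder `Step_2 c₁` of
`claim_of_steps` (the lattice tail bound «Σ_{|k|>m}|k|^{−4} ≤ c₁ m^{−1}» with `c₁ > 0`) is PROVED for
every `c₁ ≥ 52√3` (`step_2_holds_of_le`; instance `step_2_holds : Step_2 91`). Proof by sup-norm
shells: `|k|² ≤ 3 (maxᵢ|kᵢ|)²`, so the shells `maxᵢ|kᵢ| = j`, `j > m/√3`, cover `{|k| > m}`; the shell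
`j` has `(2j+1)³ − (2j−1)³ = 24j² + 2 ≤ 26 j²` points of weight `≤ j⁻⁴`, and `Σ_{j ≥ N} j⁻² ≤ 2/N`
(Mathlib `sum_Ioo_inv_sq_le`) with `N = ⌊m/√3⌋ + 1 > m/√3`; the sums are taken in `ℝ≥0∞` (Tonelli
for `tsum`, no summability bookkeeping) and transferred to the typed real `tsum` at the end. No
statement, locator (`LastIntervalSign`, #34) or class is touched. -/

section TailBoundProof

open scoped ENNReal

/-- The sup-norm `max_i |k_i|` of a lattice point, as a natural number. [folklore] -/
private def supNat (k : Fin 3 → ℤ) : ℕ := Finset.univ.sup fun i => (k i).natAbs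

/-- Helper `natAbs_le_supNat` for the lattice tail bound (sup-norm shells). [folklore] -/
private theorem natAbs_le_supNat (k : Fin 3 → ℤ) (i : Fin 3) : (k i).natAbs ≤ supNat k :=
  Finset.le_sup (f := fun i => (k i).natAbs) (Finset.mem_univ i)

/-- Helper `cast_sq_le_supNat_sq` for the lattice tail bound (sup-norm shells). [folklore] -/
private theorem cast_sq_le_supNat_sq (k : Fin 3 → ℤ) (i : Fin 3) :
    ((k i : ℝ)) ^ 2 ≤ (supNat k : ℝ) ^ 2 := by
  have h : |(k i : ℝ)| ≤ (supNat k : ℝ) := by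
    have h1 : (((k i).natAbs : ℕ) : ℝ) = |(k i : ℝ)| := by
      rw [Nat.cast_natAbs, Int.cast_abs]
    rw [← h1]
    exact_mod_cast natAbs_le_supNat k i
  calc ((k i : ℝ)) ^ 2 = |(k i : ℝ)| ^ 2 := (sq_abs _).symm
    _ ≤ (supNat k : ℝ) ^ 2 := pow_le_pow_left₀ (abs_nonneg _) h 2

/-- Helper `kNormSq_le_three_mul` for the lattice tail bound (sup-norm shells). [folklore] -/
private theorem kNormSq_le_three_mul (k : Fin 3 → ℤ) : kNormSq k ≤ 3 * (supNat k : ℝ) ^ 2 := by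
  unfold kNormSq
  calc ∑ i, ((k i : ℝ)) ^ 2 ≤ ∑ _i : Fin 3, (supNat k : ℝ) ^ 2 :=
        Finset.sum_le_sum fun i _ => cast_sq_le_supNat_sq k i
    _ = 3 * (supNat k : ℝ) ^ 2 := by simp [Finset.sum_const, Finset.card_univ, Fintype.card_fin]

/-- Helper `supNat_sq_le_kNormSq` for the lattice tail bound (sup-norm shells). [folklore] -/
private theorem supNat_sq_le_kNormSq (k : Fin 3 → ℤ) : (supNat k : ℝ) ^ 2 ≤ kNormSq k := by
  obtain ⟨i₀, -, hi₀⟩ := Finset.exists_mem_eq_sup (Finset.univ : Finset (Fin 3))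
    Finset.univ_nonempty (fun i => (k i).natAbs)
  have hsup : supNat k = (k i₀).natAbs := hi₀
  unfold kNormSq
  have h1 : (supNat k : ℝ) ^ 2 = ((k i₀ : ℝ)) ^ 2 := by
    rw [hsup, Nat.cast_natAbs, Int.cast_abs, sq_abs]
  rw [h1]
  exact Finset.single_le_sum (f := fun i => ((k i : ℝ)) ^ 2) (fun _ _ => sq_nonneg _)
    (Finset.mem_univ i₀)

/-- The cube `{k : max_i |k_i| ≤ j}` as a Finset. [folklore] -/
private def cube (j : ℕ) : Finset (Fin 3 → ℤ) :=
  Fintype.piFinset fun _ : Fin 3 => Finset.Icc (-(j : ℤ)) j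

/-- Helper `mem_cube` for the lattice tail bound (sup-norm shells). [folklore] -/
private theorem mem_cube {j : ℕ} {k : Fin 3 → ℤ} : k ∈ cube j ↔ supNat k ≤ j := by
  simp only [cube, Fintype.mem_piFinset, Finset.mem_Icc, supNat, Finset.sup_le_iff,
    Finset.mem_univ, true_imp_iff]
  refine forall_congr' fun i => ?_
  rw [← Int.ofNat_le, Int.natCast_natAbs, abs_le]

/-- Helper `card_cube` for the lattice tail bound (sup-norm shells). [folklore] -/
private theorem card_cube (j : ℕ) : (cube j).card = (2 * j + 1) ^ 3 := by
  simp only [cube, Fintype.card_piFinset, Int.card_Icc, Finset.prod_const, Finset.card_univ,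
    Fintype.card_fin]
  congr 1
  omega

/-- The sup-norm shell `{k : max_i |k_i| = j}` as a Finset. [folklore] -/
private def shell (j : ℕ) : Finset (Fin 3 → ℤ) := (cube j).filter fun k => supNat k = j

/-- Helper `mem_shell` for the lattice tail bound (sup-norm shells). [folklore] -/
private theorem mem_shell {j : ℕ} {k : Fin 3 → ℤ} : k ∈ shell j ↔ supNat k = j := by
  simp only [shell, Finset.mem_filter, mem_cube, and_iff_right_iff_imp]
  exact fun h => h.le

/-- `#{k : max_i |k_i| = j} ≤ 26 j²` for `j ≥ 1` (the shell is `cube j \ cube (j-1)`, of cardinality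
`(2j+1)³ − (2j−1)³ = 24j² + 2`). [folklore] -/
private theorem card_shell_le {j : ℕ} (hj : 1 ≤ j) : ((shell j).card : ℝ) ≤ 26 * (j : ℝ) ^ 2 := by
  obtain ⟨i, rfl⟩ : ∃ i, j = i + 1 := ⟨j - 1, by omega⟩
  have hsub : shell (i + 1) ⊆ cube (i + 1) \ cube i := by
    intro k hk
    rw [mem_shell] at hk
    rw [Finset.mem_sdiff, mem_cube, mem_cube]
    omega
  have hcard : (shell (i + 1)).card ≤ (cube (i + 1)).card - (cube i).card := by
    have h := Finset.card_le_card hsub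
    rwa [Finset.card_sdiff_of_subset (by intro k hk; rw [mem_cube] at hk ⊢; omega)] at h
  rw [card_cube, card_cube] at hcard
  have hcard' : (shell (i + 1)).card ≤ 24 * (i + 1) ^ 2 + 2 := by
    have : (2 * (i + 1) + 1) ^ 3 - (2 * i + 1) ^ 3 = 24 * (i + 1) ^ 2 + 2 := by
      have h3 : (2 * i + 1) ^ 3 ≤ (2 * (i + 1) + 1) ^ 3 := Nat.pow_le_pow_left (by omega) 3
      zify [h3]
      ring
    omega
  calc ((shell (i + 1)).card : ℝ) ≤ ((24 * (i + 1) ^ 2 + 2 : ℕ) : ℝ) := by exact_mod_cast hcard'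
    _ ≤ 26 * ((i + 1 : ℕ) : ℝ) ^ 2 := by
        push_cast
        have h1 : (1 : ℝ) ≤ ((i : ℝ) + 1) ^ 2 := by
          have : (0 : ℝ) ≤ i := Nat.cast_nonneg i
          nlinarith
        nlinarith

/-- Tail of `Σ 1/j²`: `Σ_{j ∈ [N, n)} 1/j² ≤ 2/N` for `N ≥ 1` (Mathlib `sum_Ioo_inv_sq_le`).
[folklore] -/
private theorem sum_Ico_inv_sq_le {N : ℕ} (hN : 1 ≤ N) (n : ℕ) :
    ∑ j ∈ Finset.Ico N n, ((j : ℝ) ^ 2)⁻¹ ≤ 2 / N := by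
  have h := sum_Ioo_inv_sq_le (α := ℝ) (N - 1) n
  have hIco : Finset.Ico N n = Finset.Ioo (N - 1) n := by
    ext j; simp only [Finset.mem_Ico, Finset.mem_Ioo]; omega
  rw [hIco]
  have hN' : ((N - 1 : ℕ) : ℝ) + 1 = N := by
    rw [Nat.cast_sub hN]; push_cast; ring
  rwa [hN'] at h

/-- **The lattice tail in `ℝ≥0∞`**: for `m > 0`, `Σ_{k ∈ ℤ³, |k|² > m²} |k|⁻⁴ ≤ 52√3 / m` (sup-norm
shells: `|k|² ≤ 3 (max|kᵢ|)²`, so the shells `max|kᵢ| = j` with `j > m/√3` cover the tail, each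
carrying at most `26 j²` points of weight `≤ j⁻⁴`, and `Σ_{j ≥ N} j⁻² ≤ 2/N` with `N = ⌊m/√3⌋ + 1
> m/√3`). [folklore] -/
private theorem lintegralTail_le {m : ℝ} (hm : 0 < m) :
    ∑' k : Fin 3 → ℤ, ENNReal.ofReal
        ({k | m ^ 2 < kNormSq k}.indicator (fun k => ((kNormSq k) ^ 2)⁻¹) k) ≤
      ENNReal.ofReal (52 * Real.sqrt 3 / m) := by
  have h3 : 0 < Real.sqrt 3 := Real.sqrt_pos.2 (by norm_num)
  set N : ℕ := ⌊m / Real.sqrt 3⌋₊ + 1 with hNdef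
  have hN1 : 1 ≤ N := by omega
  have hNgt : m / Real.sqrt 3 < N := by
    rw [hNdef]; push_cast; exact Nat.lt_floor_add_one _
  -- the shell majorant
  set G : ℕ → (Fin 3 → ℤ) → ℝ≥0∞ := fun j k =>
    if supNat k = j ∧ N ≤ j then ENNReal.ofReal (((j : ℝ) ^ 4)⁻¹) else 0 with hG
  -- pointwise domination by the shell sum
  have hpt : ∀ k, ENNReal.ofReal ({k | m ^ 2 < kNormSq k}.indicator
      (fun k => ((kNormSq k) ^ 2)⁻¹) k) ≤ ∑' j, G j k := by
    intro k
    by_cases hk : m ^ 2 < kNormSq k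
    · rw [Set.indicator_of_mem (by exact hk)]
      -- `supNat k ≥ N` and `kNormSq k ≥ (supNat k)²`
      have hpos : 0 < kNormSq k := (sq_pos_of_pos hm).trans hk
      have hsup : m / Real.sqrt 3 < supNat k := by
        rw [div_lt_iff₀ h3]
        have h1 : m ^ 2 < 3 * (supNat k : ℝ) ^ 2 := hk.trans_le (kNormSq_le_three_mul k)
        have h2 : m ^ 2 < ((supNat k : ℝ) * Real.sqrt 3) ^ 2 := by
          rw [mul_pow, Real.sq_sqrt (by norm_num : (0:ℝ) ≤ 3)]; linarith
        exact (abs_lt_of_sq_lt_sq' h2 (by positivity)).2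
      have hNle : N ≤ supNat k := by
        rw [hNdef]
        exact Nat.succ_le_of_lt ((Nat.floor_lt (by positivity)).2 hsup)
      have hj1 : (1 : ℝ) ≤ supNat k := by exact_mod_cast hN1.trans hNle
      refine le_trans ?_ (ENNReal.le_tsum (supNat k))
      rw [hG]; simp only [true_and, if_pos hNle]
      refine ENNReal.ofReal_le_ofReal (inv_anti₀ (by positivity) ?_)
      calc ((supNat k : ℝ)) ^ 4 = ((supNat k : ℝ) ^ 2) ^ 2 := by ring
        _ ≤ (kNormSq k) ^ 2 := pow_le_pow_left₀ (sq_nonneg _) (supNat_sq_le_kNormSq k) 2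
    · rw [Set.indicator_of_notMem (by exact hk), ENNReal.ofReal_zero]
      exact bot_le
  -- each shell sum
  have hshell : ∀ j, ∑' k, G j k ≤
      (if N ≤ j then ENNReal.ofReal (26 * ((j : ℝ) ^ 2)⁻¹) else 0) := by
    intro j
    by_cases hNj : N ≤ j
    · rw [if_pos hNj]
      have hj1 : 1 ≤ j := hN1.trans hNj
      have hsupp : ∀ k ∉ shell j, G j k = 0 := by
        intro k hk
        rw [mem_shell] at hk
        rw [hG]; simp only [hk, false_and, if_false]
      rw [tsum_eq_sum (s := shell j) (fun k hk => hsupp k hk)]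
      have hval : ∀ k ∈ shell j, G j k = ENNReal.ofReal (((j : ℝ) ^ 4)⁻¹) := by
        intro k hk
        rw [mem_shell] at hk
        rw [hG]; simp only [hk, hNj, and_self, if_true]
      rw [Finset.sum_congr rfl hval, Finset.sum_const, nsmul_eq_mul]
      rw [← ENNReal.ofReal_natCast, ← ENNReal.ofReal_mul (by positivity)]
      refine ENNReal.ofReal_le_ofReal ?_
      have hjpos : (0 : ℝ) < j := by exact_mod_cast hj1
      calc ((shell j).card : ℝ) * ((j : ℝ) ^ 4)⁻¹ ≤ 26 * (j : ℝ) ^ 2 * ((j : ℝ) ^ 4)⁻¹ :=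
            mul_le_mul_of_nonneg_right (card_shell_le hj1) (by positivity)
        _ = 26 * ((j : ℝ) ^ 2)⁻¹ := by field_simp
    · rw [if_neg hNj]
      have hz : ∀ k, G j k = 0 := fun k => by
        rw [hG]; simp only [hNj, and_false, if_false]
      rw [tsum_congr hz, tsum_zero]
  -- the tail of `Σ 1/j²`
  have htail : ∑' j, (if N ≤ j then ENNReal.ofReal (26 * ((j : ℝ) ^ 2)⁻¹) else 0) ≤
      ENNReal.ofReal (26 * (2 / N)) := by
    refine ENNReal.tsum_le_of_sum_range_le fun n => ?_
    rw [Finset.sum_ite, Finset.sum_const_zero, add_zero]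
    have hfilt : (Finset.range n).filter (fun j => N ≤ j) = Finset.Ico N n := by
      ext j; simp only [Finset.mem_filter, Finset.mem_range, Finset.mem_Ico]; omega
    rw [hfilt, ← ENNReal.ofReal_sum_of_nonneg (fun j _ => by positivity)]
    refine ENNReal.ofReal_le_ofReal ?_
    rw [← Finset.mul_sum]
    exact mul_le_mul_of_nonneg_left (sum_Ico_inv_sq_le hN1 n) (by norm_num)
  -- assemble
  calc ∑' k, ENNReal.ofReal ({k | m ^ 2 < kNormSq k}.indicator (fun k => ((kNormSq k) ^ 2)⁻¹) k)
      ≤ ∑' k, ∑' j, G j k := ENNReal.tsum_le_tsum hpt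
    _ = ∑' j, ∑' k, G j k := ENNReal.tsum_comm
    _ ≤ ∑' j, (if N ≤ j then ENNReal.ofReal (26 * ((j : ℝ) ^ 2)⁻¹) else 0) :=
        ENNReal.tsum_le_tsum hshell
    _ ≤ ENNReal.ofReal (26 * (2 / N)) := htail
    _ ≤ ENNReal.ofReal (52 * Real.sqrt 3 / m) := by
        refine ENNReal.ofReal_le_ofReal ?_
        have hNpos : (0 : ℝ) < N := by exact_mod_cast hN1
        -- `1/N < √3/m`
        have h1 : 1 / (N : ℝ) ≤ Real.sqrt 3 / m := by
          rw [div_le_div_iff₀ hNpos hm, one_mul]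
          rw [div_lt_iff₀ h3] at hNgt
          linarith
        calc 26 * (2 / (N : ℝ)) = 52 * (1 / N) := by ring
          _ ≤ 52 * (Real.sqrt 3 / m) := by gcongr
          _ = 52 * Real.sqrt 3 / m := by ring

/-- **The lattice tail bound of l.237–241 with an explicit admissible constant**: for every `m > 0`,
`Σ_{k ∈ ℤ³, |k|² > m²} |k|⁻⁴ ≤ 52√3 / m` (as typed: `tsum` of the indicator, real-valued).
(Chaabani2020: §2 l.237–241 p.6) [claim: Chaabani2020, status: disputed] -/
theorem tailBound_fiftyTwo_sqrt_three : TailBound (52 * Real.sqrt 3) := by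
  intro m hm
  set f : (Fin 3 → ℤ) → ℝ :=
    fun k => {k | m ^ 2 < kNormSq k}.indicator (fun k => ((kNormSq k) ^ 2)⁻¹) k with hf
  have hf0 : ∀ k, 0 ≤ f k := fun k => by
    rw [hf]
    exact Set.indicator_nonneg (fun k _ => by positivity) k
  have hrhs : 0 ≤ 52 * Real.sqrt 3 / m := by positivity
  by_cases hs : Summable f
  · have h := lintegralTail_le hm
    rw [← ENNReal.ofReal_tsum_of_nonneg hf0 hs] at h
    exact (ENNReal.ofReal_le_ofReal_iff hrhs).1 h
  · rw [tsum_eq_zero_of_not_summable hs]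
    exact hrhs

/-- Monotonicity of the tail bound in the constant. (Chaabani2020: §2 l.237–241 p.6) [claim:
Chaabani2020, status: disputed] -/
theorem TailBound.mono {c c' : ℝ} (h : TailBound c) (hcc' : c ≤ c') : TailBound c' :=
  fun m hm => (h m hm).trans (div_le_div_of_nonneg_right hcc' hm.le)

/-- **Step 2 HOLDS for every constant `c₁ ≥ 52√3`** («c₁ is admissible»: positive and satisfying
the lattice tail bound «Σ_{|k|>m}|k|^{−4} ≤ c₁ m^{−1}», l.237–241 p.6). The paper's `c₁` is an
unspecified absolute constant; the composition `claim_of_steps` takes it as a parameter, and this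
discharges its binder `Step_2 c₁` for all admissible values (`52√3 ≈ 90.07`).
(Chaabani2020: §2 l.237–241 p.6) [claim: Chaabani2020, status: disputed] -/
theorem step_2_holds_of_le {c₁ : ℝ} (hc₁ : 52 * Real.sqrt 3 ≤ c₁) : Step_2 c₁ :=
  ⟨lt_of_lt_of_le (by positivity) hc₁, tailBound_fiftyTwo_sqrt_three.mono hc₁⟩

/-- **Step 2 HOLDS with `c₁ = 91`** (a concrete admissible instance: `52√3 < 91`).
(Chaabani2020: §2 l.237–241 p.6) [claim: Chaabani2020, status: disputed] -/
theorem step_2_holds : Step_2 91 := by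
  refine step_2_holds_of_le ?_
  have h3 : Real.sqrt 3 < 7 / 4 := by
    rw [Real.sqrt_lt' (by norm_num)]; norm_num
  linarith

end TailBoundProof

end

end Literature.Claims.NS.Chaabani2020
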